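import Literature.MathematicalPhysics.QuantumLattice.DWaveKomaTasakiSystem
import Literature.MathematicalPhysics.QuantumLattice.DWaveSourceNNNHopping
import Literature.MathematicalPhysics.QuantumLattice.HubbardNNNHoppingInteractionTorus
import HarnessLib

/-!
# The `t–t'` Hubbard torus with the `d`-wave pair field as a Koma–Tasaki bounded-overlap `U(1)` system
# (3 × 3 block locality for the next-nearest-neighbour hopping)

Topic `Literature/MathematicalPhysics/QuantumLattice` (namespace = path; family `hubbard`). The `t' ≠ 0` TWIN of
`DWaveKomaTasakiSystem.lean` (hubbard-cq-p4 g0: the nearest-neighbour grand-canonical Hubbard torus `H(t,U) − μN`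
as a `KomaTasaki.U1OverlapSystem` with plaquette-local terms), written for the Koma–Tasaki dictionary of the
Hubbard cuprate cell (`hubbard-cq`; the second CQ anchor has `t' = −1/4`): it makes the tree's finite-volume,
explicit-constant Koma–Tasaki theorems (`U1OverlapSystem.theorem_2_5_orderOne_fin`, `komaTasakiU1Field_holds`,
and their thermal `Z2System` relatives) applicable to the `t–t'` torus
`hubbardTorusTT' L 1 t' U − μN = dWaveSourceTorusTT' L t' U μ 0`.

Geometry: the Hubbard terms (`hubbardTermOp`) of the nearest-neighbour graph anchored at `y` live on the plaquette
`plaq y` (the `d`-wave pair `P_y` too); the DIAGONAL hopping terms (`fermionTorusDiagGraph`) anchored at `y` live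
on the `3 × 3` BLOCK `block y = {y + v : v ∈ {−1,0,1}²}` (`hubbardTermSupp_subset_block`). Hence
`h_y := localHam y + localDiag y ∈ 𝔄⁺(block y)`, `Σ_y h_y = hubbardTorusTT' L 1 t' U − μN` (`sum_localHamTT'`),
`‖h_y‖ ≤ 45(2 + |U| + 2|μ|) + 18|t'|`, and `h_x` commutes with the pair densities `o_y` unless `block x` meets
`plaq y` (`suppTT' x`, at most `45` sites).

* `dWaveKTSystemTT' L t' U μ g` — the `U1OverlapSystem` (`r = 45`, `r' = 25`, `h̄ = 45(2+|U|+2|μ|)+18|t'|`,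
  `ō = 2K_g`); dictionary: `dWaveKTSystemTT'_hamiltonian` (`= toEuclideanCLM (hubbardTorusTT' L 1 t' U − μN)`),
  `_order_zero`, `_C`, `_obar/_hbar/_r/_r'`, `dWaveKTSystemTT'_field B`
  (`H − B·O = toEuclideanCLM (dWaveSourceTorusTT' L t' U μ B)` for `g = dWaveFormFactor`);
* `dWaveKTSystemTT'_isLROEigenstate` — hypothesis iv) from matrix data (unit `N`-eigenvector ground state of
  `hubbardTorusTT' − μN` with `(μ'·2K_g·L²)² ≤ Re Φ†(Δ_g+Δ_g†)²Φ`).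

At `t' = 0` the Hamiltonian is `hubbardTorusWith 2 L 1 U μ` and the theorems of the `t' = 0` files apply verbatim;
this file only widens the supports. Everything is PROVED; one definition (the instance) plus bookkeeping
definitions (`block`, `diagTermAnchor`, `localDiag`, `localHamTT'`, `suppTT'`); no named fact; zero compute.

## References
* T. Koma, H. Tasaki, J. Stat. Phys. 76 (1994) 745–803, §2.3 (hypotheses i)–iv)), §3.3–3.4 (lattice fermions).
  [cite: KomaTasaki1994, §2.3, §3.3–3.4]
* T. Koma, H. Tasaki, Commun. Math. Phys. 158 (1993) 191, §7. [cite: KomaTasaki1993, §7]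
* H. Xu et al., Science 384 (2024) eadh7691, eq. (1) (the `t–t'` model). [cite: XuEtAl2024, eq. (1) p. 2]
-/

noncomputable section

open Matrix Complex Finset WithLp Literature.Probability.LatticeModels
open Literature.Barriers.HubbardSuperconductivity
open scoped Matrix.Norms.L2Operator InnerProductSpace ComplexConjugate ComplexOrder

namespace Literature.MathematicalPhysics.QuantumLattice

-- ONE `DecidableEq (FermionTorus 2 L)` instance for the whole file: the `t' = 0` file's
-- `instDecidableEqFermionTorusKT := LinearOrder.toDecidableEq`, re-activated locally (same NAME as there, so
-- that the dictionary lemmas of both files meet definitionally; cf. `DWaveSourceKomaTasakiField.lean`).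
attribute [local instance 10000] instDecidableEqFermionTorusKT

open DWaveKT

namespace DWaveKTNNN

variable (L : ℕ) [NeZero L]

/-! ### The `3 × 3` block -/

/-- The `3 × 3` block `{y + v : v ∈ {−1,0,1}²}` around `y`, as a set of fermionic-torus sites: it carries the
plaquette of `y` and every diagonal hopping term anchored at `y`. [cite: KomaTasaki1994, §2.3 ii), §3.3] -/
def block (y : TorusSite 2 L) : Finset (FermionTorus 2 L) :=
  (box 2 1).image fun v => FermionTorus.ofTorusSite (y + Torus.proj L v)

omit [NeZero L] in
/-- `|{−1,0,1}²| = 9`. [folklore] -/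
private theorem card_box_one : (box 2 1).card = 9 := by
  rw [card_box]; norm_num

/-- `|block y| ≤ 9`. [cite: KomaTasaki1994, §2.3 ii)] -/
theorem card_block_le (y : TorusSite 2 L) : (block L y).card ≤ 9 :=
  Finset.card_image_le.trans (card_box_one).le

/-- `y + v ∈ block y` for `v ∈ {−1,0,1}²`. [cite: KomaTasaki1994, §2.3 ii)] -/
theorem add_mem_block (y : TorusSite 2 L) {v : Site 2} (hv : v ∈ box 2 1) :
    FermionTorus.ofTorusSite (y + Torus.proj L v) ∈ block L y :=
  Finset.mem_image_of_mem _ hv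

omit [NeZero L] in
/-- The steps `{0, ±e₁, ±e₂}` lie in `{−1,0,1}²`. [folklore] -/
private theorem steps_subset_box : insert (0 : Site 2) unitSteps ⊆ box 2 1 := by
  intro e he
  simp only [unitSteps, Finset.mem_insert, Finset.mem_singleton] at he
  rw [mem_box]
  intro i
  rcases he with rfl | rfl | rfl | rfl | rfl <;> fin_cases i <;> simp

/-- `plaq y ⊆ block y`. [cite: KomaTasaki1994, §3.3] -/
theorem plaq_subset_block (y : TorusSite 2 L) : plaq L y ⊆ block L y := by
  intro z hz
  rw [plaq, Finset.mem_image] at hz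
  obtain ⟨e, he, rfl⟩ := hz
  exact add_mem_block L y (steps_subset_box he)

omit [NeZero L] in
/-- The diagonal vectors `e₁ ± e₂` and their negatives lie in `{−1,0,1}²`. [folklore] -/
private theorem diagVec_mem_box (s : Fin 2) : diagVec s ∈ box 2 1 ∧ -diagVec s ∈ box 2 1 := by
  constructor <;> (rw [mem_box]; intro i; fin_cases s <;> fin_cases i <;> simp [diagVec])

omit [NeZero L] in
/-- `Torus.proj` is odd. [folklore] -/
private theorem proj_neg' (v : Site 2) : Torus.proj L (-v) = -Torus.proj L v := by
  funext j; simp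

/-- The diagonal neighbours `y ± (e₁ ± e₂)` of `y` lie in `block y`. [cite: KomaTasaki1994, §2.3 ii)] -/
theorem add_torusDiagJump_mem_block (y : TorusSite 2 L) (s : Fin 2) :
    FermionTorus.ofTorusSite (y + torusDiagJump L s) ∈ block L y ∧
      FermionTorus.ofTorusSite (y - torusDiagJump L s) ∈ block L y := by
  constructor
  · have h := add_mem_block L y (diagVec_mem_box s).1
    rwa [proj_diagVec] at h
  · have h := add_mem_block L y (diagVec_mem_box s).2
    rwa [proj_neg', proj_diagVec, ← sub_eq_add_neg] at h

/-- `y ∈ block y`. [cite: KomaTasaki1994, §2.3 ii)] -/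
theorem self_mem_block (y : TorusSite 2 L) : FermionTorus.ofTorusSite y ∈ block L y := by
  have h := add_mem_block L y (show (0 : Site 2) ∈ box 2 1 by rw [mem_box]; intro i; simp)
  have h0 : Torus.proj L (0 : Site 2) = 0 := by funext i; simp
  rwa [h0, add_zero] at h

/-! ### The diagonal hopping terms anchored at a site -/

/-- The anchor of a diagonal hopping term (first endpoint of the ordered bond; the site terms of the diagonal
graph are `0` since `U = μ = 0` there, anchored at their site). [cite: KomaTasaki1994, §3.3 (2.3)] -/
def diagTermAnchor : HubbardIdx (fermionTorusDiagGraph L) → TorusSite 2 L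
  | Sum.inl p => FermionTorus.toTorusSite p.1.1
  | Sum.inr x => FermionTorus.toTorusSite x

/-- A diagonal neighbour of `x` lies in `block x`. [folklore] -/
private theorem mem_block_of_diagAdj {x x' : FermionTorus 2 L} (h : (fermionTorusDiagGraph L).Adj x x') :
    x' ∈ block L (FermionTorus.toTorusSite x) := by
  rw [fermionTorusDiagGraph_adj, torusDiagGraph, SimpleGraph.fromRel_adj] at h
  obtain ⟨-, ⟨s, hs⟩ | ⟨s, hs⟩⟩ := h
  · have hmem := (add_torusDiagJump_mem_block L (FermionTorus.toTorusSite x) s).1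
    rw [← hs, FermionTorus.ofTorusSite_toTorusSite] at hmem
    exact hmem
  · have hmem := (add_torusDiagJump_mem_block L (FermionTorus.toTorusSite x) s).2
    have hx' : FermionTorus.toTorusSite x - torusDiagJump L s = FermionTorus.toTorusSite x' := by
      rw [hs, add_sub_cancel_right]
    rw [hx', FermionTorus.ofTorusSite_toTorusSite] at hmem
    exact hmem

/-- Every diagonal term is supported in the block of its anchor. [cite: KomaTasaki1994, §2.3 ii)] -/
theorem hubbardTermSupp_subset_block (Z : HubbardIdx (fermionTorusDiagGraph L)) :
    hubbardTermSupp (fermionTorusDiagGraph L) Z ⊆ block L (diagTermAnchor L Z) := by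
  rcases Z with p | x
  · intro z hz
    simp only [hubbardTermSupp, Finset.mem_insert, Finset.mem_singleton] at hz
    rcases hz with rfl | rfl
    · have h := self_mem_block L (FermionTorus.toTorusSite p.1.1)
      rw [FermionTorus.ofTorusSite_toTorusSite] at h
      exact h
    · exact mem_block_of_diagAdj L p.2
  · intro z hz
    simp only [hubbardTermSupp, Finset.mem_singleton] at hz
    rw [hz]
    have h := self_mem_block L (FermionTorus.toTorusSite x)
    rw [FermionTorus.ofTorusSite_toTorusSite] at h
    exact h

/-- The anchor lies in the support of its term. [folklore] -/
private theorem anchor_mem_hubbardTermSupp (Z : HubbardIdx (fermionTorusDiagGraph L)) :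
    FermionTorus.ofTorusSite (diagTermAnchor L Z) ∈ hubbardTermSupp (fermionTorusDiagGraph L) Z := by
  rcases Z with p | x
  · simp [diagTermAnchor, hubbardTermSupp, FermionTorus.ofTorusSite_toTorusSite]
  · simp [diagTermAnchor, hubbardTermSupp, FermionTorus.ofTorusSite_toTorusSite]

/-- Degrees of the diagonal graph are `≤ 4` (neighbours of `v` lie in `{v ± (e₁ + e₂), v ± (e₁ − e₂)}`).
[folklore] -/
private theorem card_filter_fermionTorusDiagGraph_adj_le (v : FermionTorus 2 L) :
    (Finset.univ.filter ((fermionTorusDiagGraph L).Adj v)).card ≤ 4 := by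
  classical
  have hsub : (Finset.univ.filter ((fermionTorusDiagGraph L).Adj v)).image FermionTorus.toTorusSite ⊆
      (Finset.univ : Finset (Fin 2 × Bool)).image fun p =>
        if p.2 then v.toTorusSite + torusDiagJump L p.1 else v.toTorusSite - torusDiagJump L p.1 := by
    intro z hz
    obtain ⟨w, hw, rfl⟩ := Finset.mem_image.1 hz
    have hadj : (torusDiagGraph L).Adj v.toTorusSite w.toTorusSite := (Finset.mem_filter.1 hw).2
    rw [torusDiagGraph, SimpleGraph.fromRel_adj] at hadj
    obtain ⟨-, ⟨s, h⟩ | ⟨s, h⟩⟩ := hadj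
    · exact Finset.mem_image.2 ⟨(s, true), Finset.mem_univ _, by simp [h]⟩
    · refine Finset.mem_image.2 ⟨(s, false), Finset.mem_univ _, ?_⟩
      simp only [if_false, Bool.false_eq_true]
      rw [h, add_sub_cancel_right]
  calc (Finset.univ.filter ((fermionTorusDiagGraph L).Adj v)).card
      = ((Finset.univ.filter ((fermionTorusDiagGraph L).Adj v)).image FermionTorus.toTorusSite).card :=
        (Finset.card_image_of_injective _ FermionTorus.equivTorusSite.injective).symm
    _ ≤ ((Finset.univ : Finset (Fin 2 × Bool)).image fun p =>
          if p.2 then v.toTorusSite + torusDiagJump L p.1 else v.toTorusSite - torusDiagJump L p.1).card :=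
        Finset.card_le_card hsub
    _ ≤ (Finset.univ : Finset (Fin 2 × Bool)).card := Finset.card_image_le
    _ = 4 := by simp

variable (t' : ℝ)

/-- **The diagonal part of the local Hamiltonian**: the diagonal hopping terms (`t'`, no on-site part) anchored
at `y`. [cite: KomaTasaki1994, §3.3 (2.3)] [cite: XuEtAl2024, eq. (1) p. 2] -/
def localDiag (y : TorusSite 2 L) :
    Matrix (Finset (Orb (FermionTorus 2 L))) (Finset (Orb (FermionTorus 2 L))) ℂ :=
  ∑ Z ∈ Finset.univ.filter (fun Z => diagTermAnchor L Z = y), hubbardTermOp (fermionTorusDiagGraph L) t' 0 0 Z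

/-- `Σ_y localDiag y = hamiltonian (fermionTorusDiagGraph L) t' 0` (the next-nearest-neighbour hopping).
[cite: XuEtAl2024, eq. (1) p. 2] -/
theorem sum_localDiag : ∑ y, localDiag L t' y = hamiltonian (fermionTorusDiagGraph L) t' 0 := by
  have h : ∑ y, localDiag L t' y = hamiltonianWith (fermionTorusDiagGraph L) t' 0 0 := by
    rw [← sum_hubbardTermOp]
    exact Finset.sum_fiberwise Finset.univ (diagTermAnchor L) _
  rw [h, hamiltonianWith_zero]

omit [NeZero L] in
/-- `localDiag y` is Hermitian. [cite: KomaTasaki1994, §2.1] -/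
theorem isHermitian_localDiag (y : TorusSite 2 L) : (localDiag L t' y).IsHermitian :=
  isHermitian_finset_sum _ fun Z _ => isHermitian_hubbardTermOp _ t' 0 0 Z

/-- `localDiag y` is an even operator localised on `block y`. [cite: KomaTasaki1994, §2.3 ii)] -/
theorem localDiag_mem (y : TorusSite 2 L) : localDiag L t' y ∈ carEvenSubalgebra (orbSet (block L y)) := by
  refine Subalgebra.sum_mem _ fun Z hZ => ?_
  rw [Finset.mem_filter] at hZ
  have h := hubbardTermSupp_subset_block L Z
  rw [hZ.2] at h
  exact carEvenSubalgebra_mono (orbSet_mono h) (hubbardTermOp_mem_carEvenSubalgebra _ t' 0 0 Z)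

/-- `‖localDiag y‖ ≤ 18|t'|`: at most `9` diagonal terms are anchored at `y` (their supports contain `y`;
degrees `≤ 4`), each of norm `≤ 2|t'|`. [cite: KomaTasaki1994, §2.3 iii)] -/
theorem norm_localDiag_le (y : TorusSite 2 L) : ‖localDiag L t' y‖ ≤ 18 * |t'| := by
  classical
  have hsub : Finset.univ.filter (fun Z => diagTermAnchor L Z = y) ⊆
      Finset.univ.filter fun Z : HubbardIdx (fermionTorusDiagGraph L) =>
        ¬ Disjoint (hubbardTermSupp (fermionTorusDiagGraph L) Z) {FermionTorus.ofTorusSite y} := by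
    intro Z hZ
    rw [Finset.mem_filter] at hZ ⊢
    refine ⟨Finset.mem_univ _, ?_⟩
    rw [Finset.disjoint_singleton_right, not_not, ← hZ.2]
    exact anchor_mem_hubbardTermSupp L Z
  have hcard : (Finset.univ.filter (fun Z => diagTermAnchor L Z = y)).card ≤ 9 := by
    refine (Finset.card_le_card hsub).trans ?_
    refine (card_filter_not_disjoint_hubbardTermSupp_le (fermionTorusDiagGraph L)
      (card_filter_fermionTorusDiagGraph_adj_le L) {FermionTorus.ofTorusSite y}).trans ?_
    simp
  have hterm : ∀ Z : HubbardIdx (fermionTorusDiagGraph L),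
      ‖hubbardTermOp (fermionTorusDiagGraph L) t' 0 0 Z‖ ≤ 2 * |t'| := by
    intro Z
    have h := norm_hubbardTermOp_le (fermionTorusDiagGraph L) t' 0 0 Z
    simpa using h
  calc ‖localDiag L t' y‖
      ≤ ∑ Z ∈ Finset.univ.filter (fun Z => diagTermAnchor L Z = y),
          ‖hubbardTermOp (fermionTorusDiagGraph L) t' 0 0 Z‖ := norm_sum_le _ _
    _ ≤ ∑ _Z ∈ Finset.univ.filter (fun Z => diagTermAnchor L Z = y), 2 * |t'| :=
        Finset.sum_le_sum fun Z _ => hterm Z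
    _ = (Finset.univ.filter (fun Z => diagTermAnchor L Z = y)).card * (2 * |t'|) := by
        rw [Finset.sum_const, nsmul_eq_mul]
    _ ≤ 9 * (2 * |t'|) := by
        have : ((Finset.univ.filter (fun Z => diagTermAnchor L Z = y)).card : ℝ) ≤ 9 := by exact_mod_cast hcard
        exact mul_le_mul_of_nonneg_right this (by positivity)
    _ = 18 * |t'| := by ring

variable (U μ : ℝ)

/-- **The local Hamiltonian of the `t–t'` torus**: `h_y = localHam y + localDiag y` (nearest-neighbour hopping with
`t = 1`, on-site `U n↑n↓ − μn`, and the diagonal hopping anchored at `y`). [cite: XuEtAl2024, eq. (1) p. 2] -/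
def localHamTT' (y : TorusSite 2 L) :
    Matrix (Finset (Orb (FermionTorus 2 L))) (Finset (Orb (FermionTorus 2 L))) ℂ :=
  localHam L 1 U μ y + localDiag L t' y

/-- **`Σ_y h_y = hubbardTorusTT' L 1 t' U − μN`** (`= dWaveSourceTorusTT' L t' U μ 0`). [cite: XuEtAl2024, eq. (1) p. 2] -/
theorem sum_localHamTT' :
    ∑ y, localHamTT' L t' U μ y = hubbardTorusTT' L 1 t' U - (μ : ℂ) • totalNumber := by
  simp only [localHamTT', Finset.sum_add_distrib, sum_localHam, sum_localDiag, hubbardTorusWith_eq,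
    hubbardTorusTT', hubbardTorus]
  abel

/-- The same as the zero-field sourced torus: `Σ_y h_y = dWaveSourceTorusTT' L t' U μ 0`. [cite: KomaTasaki1994, §1] -/
theorem sum_localHamTT'_eq_dWaveSourceTorusTT' :
    ∑ y, localHamTT' L t' U μ y = dWaveSourceTorusTT' L t' U μ 0 := by
  rw [sum_localHamTT', dWaveSourceTorusTT', Complex.ofReal_zero, zero_smul, sub_zero]

omit [NeZero L] in
/-- `h_y` is Hermitian. [cite: KomaTasaki1994, §2.1] -/
theorem isHermitian_localHamTT' (y : TorusSite 2 L) : (localHamTT' L t' U μ y).IsHermitian :=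
  (isHermitian_localHam L 1 U μ y).add (isHermitian_localDiag L t' y)

/-- `h_y` is an even operator localised on `block y`. [cite: KomaTasaki1994, §2.3 ii)] -/
theorem localHamTT'_mem (y : TorusSite 2 L) :
    localHamTT' L t' U μ y ∈ carEvenSubalgebra (orbSet (block L y)) :=
  Subalgebra.add_mem _
    (carEvenSubalgebra_mono (orbSet_mono (plaq_subset_block L y)) (localHam_mem L 1 U μ y))
    (localDiag_mem L t' y)

/-- `‖h_y‖ ≤ 45(2 + |U| + 2|μ|) + 18|t'|`. [cite: KomaTasaki1994, §2.3 iii)] -/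
theorem norm_localHamTT'_le (y : TorusSite 2 L) :
    ‖localHamTT' L t' U μ y‖ ≤ 45 * (2 + |U| + 2 * |μ|) + 18 * |t'| := by
  have h1 := norm_localHam_le L 1 U μ y
  rw [abs_one, mul_one] at h1
  exact (norm_add_le _ _).trans (add_le_add h1 (norm_localDiag_le L t' y))

/-! ### The support sets: which pair densities can fail to commute with `h_x` -/

/-- The sites `y` whose plaquette meets the block of `x` (outside it `h_x` and `o_y` commute).
[cite: KomaTasaki1994, §2.3 ii)] -/
def suppTT' (x : TorusSite 2 L) : Finset (TorusSite 2 L) :=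
  Finset.univ.filter fun y => ¬ Disjoint (block L x) (plaq L y)

/-- Outside `suppTT' x` the block of `x` and the plaquette of `y` are disjoint. [cite: KomaTasaki1994, §2.3 ii)] -/
theorem disjoint_block_plaq_of_not_mem {x y : TorusSite 2 L} (h : y ∉ suppTT' L x) :
    Disjoint (block L x) (plaq L y) := by
  simpa [suppTT'] using h

/-- `|suppTT' x| ≤ 45` (a meeting point `x + v = y + e` determines `y = x + v − e`, `(v,e) ∈ {−1,0,1}² × {0,±e₁,±e₂}`).
[cite: KomaTasaki1994, §2.3 ii)] -/
theorem card_suppTT'_le (x : TorusSite 2 L) : (suppTT' L x).card ≤ 45 := by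
  classical
  set S : Finset (Site 2) := insert 0 unitSteps with hS
  have hScard : S.card ≤ 5 := by
    rw [hS]
    refine (Finset.card_insert_le _ _).trans ?_
    have : unitSteps.card ≤ 4 := by
      unfold unitSteps
      refine (Finset.card_insert_le _ _).trans ?_
      refine Nat.succ_le_succ ((Finset.card_insert_le _ _).trans ?_)
      refine Nat.succ_le_succ ((Finset.card_insert_le _ _).trans ?_)
      simp
    omega
  have hsub : suppTT' L x ⊆ (box 2 1 ×ˢ S).image fun p => x + Torus.proj L p.1 - Torus.proj L p.2 := by
    intro y hy
    rw [suppTT', Finset.mem_filter, Finset.not_disjoint_iff] at hy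
    obtain ⟨z, hz, hz'⟩ := hy.2
    rw [block, Finset.mem_image] at hz
    rw [plaq, Finset.mem_image] at hz'
    obtain ⟨v, hv, rfl⟩ := hz
    obtain ⟨e, he, heq⟩ := hz'
    have hinj := FermionTorus.equivTorusSite.symm.injective
      (show FermionTorus.ofTorusSite (y + Torus.proj L e) = FermionTorus.ofTorusSite (x + Torus.proj L v)
        from heq)
    refine Finset.mem_image.2 ⟨(v, e), Finset.mk_mem_product hv he, ?_⟩
    simp only
    rw [← hinj]; abel
  calc (suppTT' L x).card ≤ ((box 2 1 ×ˢ S).image fun p => x + Torus.proj L p.1 - Torus.proj L p.2).card :=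
        Finset.card_le_card hsub
    _ ≤ (box 2 1 ×ˢ S).card := Finset.card_image_le
    _ = (box 2 1).card * S.card := Finset.card_product _ _
    _ ≤ 9 * 5 := Nat.mul_le_mul (card_box_one).le hScard

/-! ### Transport to `EuclideanSpace` (private copies of the `t' = 0` file's helpers) -/

/-- A Hermitian matrix acts as a symmetric operator on `EuclideanSpace ℂ n`. [folklore] -/
private theorem isSymmetric_toEuclideanCLM' {n : Type*} [Fintype n] [DecidableEq n] {A : Matrix n n ℂ}
    (hA : A.IsHermitian) :
    ((toEuclideanCLM (n := n) (𝕜 := ℂ) A : EuclideanSpace ℂ n →L[ℂ] EuclideanSpace ℂ n) :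
      EuclideanSpace ℂ n →ₗ[ℂ] EuclideanSpace ℂ n).IsSymmetric :=
  ContinuousLinearMap.isSelfAdjoint_iff_isSymmetric.mp ((Matrix.isSelfAdjoint_toEuclideanCLM_iff A).mpr hA)

/-- Commuting matrices give commuting operators. [folklore] -/
private theorem commute_toEuclideanCLM' {n : Type*} [Fintype n] [DecidableEq n] {A B : Matrix n n ℂ}
    (h : Commute A B) :
    Commute (toEuclideanCLM (n := n) (𝕜 := ℂ) A) (toEuclideanCLM (n := n) (𝕜 := ℂ) B) := by
  have := congrArg (toEuclideanCLM (n := n) (𝕜 := ℂ)) h.eq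
  rw [map_mul, map_mul] at this
  exact this

/-- Outside the overlap set the plaquettes are disjoint (public restatement of the `t' = 0` file's private
helper). [cite: KomaTasaki1994, §2.3 i)] -/
theorem disjoint_plaq_of_not_mem_overlapSet {y y' : TorusSite 2 L} (h : y' ∉ overlapSet L y) :
    Disjoint (plaq L y) (plaq L y') := by
  simpa [overlapSet] using h

end DWaveKTNNN

open DWaveKTNNN

/-! ### The instance -/

section Instance

variable (L : ℕ) [NeZero L] (t' U μ : ℝ) (g : Site 2 → ℝ)

/-- **The grand-canonical `t–t'` Hubbard torus with the pair field `Δ_g` as a bounded-overlap Koma–Tasaki `U(1)`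
system**: `Λ = (ℤ/Lℤ)²`, Hilbert space the fermionic Fock space (as `EuclideanSpace`), `h_y = localHamTT' y`
(`3 × 3`-block local), `o^{(1)}_y = P_y + P_y†`, `o^{(2)}_y = i(P_y − P_y†)`, `C = N/2`, `S_y = suppTT' y` (`r = 45`),
`T_y = overlapSet y` (`r' = 25`), `h̄ = 45(2+|U|+2|μ|) + 18|t'|`, `ō = 2K_g`.
[cite: KomaTasaki1994, §3.3–3.4, §2.3 (2.12)–(2.17)] [cite: KomaTasaki1993, §7 (before Theorem 7.3)] -/
def dWaveKTSystemTT' (hg : 0 < pairNormConst g) :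
    KomaTasaki.U1OverlapSystem (TorusSite 2 L) (EuclideanSpace ℂ (FockIdx L)) where
  h y := toEuclideanCLM (n := FockIdx L) (𝕜 := ℂ) (localHamTT' L t' U μ y)
  o α y := toEuclideanCLM (n := FockIdx L) (𝕜 := ℂ) (pairDensity L g α y)
  C := toEuclideanCLM (n := FockIdx L) (𝕜 := ℂ) ((2 : ℂ)⁻¹ • totalNumber)
  supp := suppTT' L
  r := 45
  osupp := overlapSet L
  r' := 25
  hbar := 45 * (2 + |U| + 2 * |μ|) + 18 * |t'|
  obar := 2 * pairNormConst g
  isSymmetric_h y := isSymmetric_toEuclideanCLM' (isHermitian_localHamTT' L t' U μ y)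
  isSymmetric_o α y := isSymmetric_toEuclideanCLM' (isHermitian_pairDensity L g α y)
  isSymmetric_C := isSymmetric_toEuclideanCLM'
    (IsHermitian.smul totalNumber_isHermitian (by rw [IsSelfAdjoint]; simp))
  commute_hamiltonian_C := by
    rw [← map_sum, sum_localHamTT']
    refine commute_toEuclideanCLM' (Commute.smul_right ?_ _)
    exact (hubbardTorusTT'_commute_totalNumber L 1 t' U).sub_left
      ((Commute.refl totalNumber).smul_left (μ : ℂ))
  order_zero_C := by
    rw [← map_sum, ← map_sum, sum_pairDensity_zero, sum_pairDensity_one, ← map_mul, ← map_mul,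
      ← map_sub, order_zero_comm_halfNumber, map_neg, map_smul]
  order_one_C := by
    rw [← map_sum, ← map_sum, sum_pairDensity_zero, sum_pairDensity_one, ← map_mul, ← map_mul,
      ← map_sub, order_one_comm_halfNumber, map_smul]
  commute_o x y hy α β :=
    commute_toEuclideanCLM' (commute_of_mem_carEvenSubalgebra (pairDensity_mem L g α x)
      ((carEvenSubalgebra_le_carSubalgebra _) (pairDensity_mem L g β y))
      (disjoint_orbSet (disjoint_plaq_of_not_mem_overlapSet L hy)))
  card_osupp_le := card_overlapSet_le L
  commute_h_o x y hy α :=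
    commute_toEuclideanCLM' (commute_of_mem_carEvenSubalgebra (localHamTT'_mem L t' U μ x)
      ((carEvenSubalgebra_le_carSubalgebra _) (pairDensity_mem L g α y))
      (disjoint_orbSet (disjoint_block_plaq_of_not_mem L hy)))
  card_supp_le := card_suppTT'_le L
  two_le_r := by norm_num
  norm_h_le y := by rw [Matrix.l2_opNorm_toEuclideanCLM]; exact norm_localHamTT'_le L t' U μ y
  norm_o_le α y := by rw [Matrix.l2_opNorm_toEuclideanCLM]; exact norm_pairDensity_le L g α y
  obar_pos := by positivity

end Instance

/-! ### Dictionary: the instance's operators in matrix terms, hypothesis iv) -/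

section Dictionary

variable {L : ℕ} [NeZero L] (t' U μ : ℝ) (g : Site 2 → ℝ) (hg : 0 < pairNormConst g)

/-- `|Λ| = L²`. [folklore] -/
private theorem card_torusSite_sq' : Fintype.card (TorusSite 2 L) = L ^ 2 := by
  simp [TorusSite, ZMod.card]

omit [NeZero L] in
/-- `⟨toLp x, toLp y⟩ = x† y`. [folklore] -/
private theorem inner_toLp_toLp_eq' (x y : FockIdx L → ℂ) :
    ⟪(toLp 2 x : EuclideanSpace ℂ (FockIdx L)), toLp 2 y⟫_ℂ = star x ⬝ᵥ y := by
  rw [EuclideanSpace.inner_toLp_toLp, dotProduct_comm]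

omit [NeZero L] in
/-- `‖toLp v‖² = Re v†v`. [folklore] -/
private theorem norm_toLp_sq_eq' (v : FockIdx L → ℂ) :
    ‖(toLp 2 v : EuclideanSpace ℂ (FockIdx L))‖ ^ 2 = (star v ⬝ᵥ v).re := by
  rw [← inner_toLp_toLp_eq', ← inner_self_eq_norm_sq (𝕜 := ℂ)]
  rfl

/-- `H_sys = toEuclideanCLM (hubbardTorusTT' L 1 t' U − μN)`. [cite: KomaTasaki1994, (2.3), §3.3] -/
theorem dWaveKTSystemTT'_hamiltonian :
    (dWaveKTSystemTT' L t' U μ g hg).hamiltonian =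
      toEuclideanCLM (n := FockIdx L) (𝕜 := ℂ) (hubbardTorusTT' L 1 t' U - (μ : ℂ) • totalNumber) := by
  change ∑ y, toEuclideanCLM (n := FockIdx L) (𝕜 := ℂ) (localHamTT' L t' U μ y) = _
  rw [← map_sum, sum_localHamTT']

/-- `O^{(1)}_sys = toEuclideanCLM (Δ_g + Δ_g†)`. [cite: KomaTasaki1994, (2.13), §3.3] -/
theorem dWaveKTSystemTT'_order_zero :
    (dWaveKTSystemTT' L t' U μ g hg).order 0 =
      toEuclideanCLM (n := FockIdx L) (𝕜 := ℂ) (pairField g L + (pairField g L)ᴴ) := by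
  change ∑ y, toEuclideanCLM (n := FockIdx L) (𝕜 := ℂ) (pairDensity L g 0 y) = _
  rw [← map_sum, sum_pairDensity_zero]

/-- `O^{(2)}_sys = toEuclideanCLM (i(Δ_g − Δ_g†))`. [cite: KomaTasaki1994, (2.13), §3.3] -/
theorem dWaveKTSystemTT'_order_one :
    (dWaveKTSystemTT' L t' U μ g hg).order 1 =
      toEuclideanCLM (n := FockIdx L) (𝕜 := ℂ) (I • (pairField g L - (pairField g L)ᴴ)) := by
  change ∑ y, toEuclideanCLM (n := FockIdx L) (𝕜 := ℂ) (pairDensity L g 1 y) = _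
  rw [← map_sum, sum_pairDensity_one]

/-- `C_sys = toEuclideanCLM (N/2)`. [cite: KomaTasaki1994, (2.12), §3.3] -/
theorem dWaveKTSystemTT'_C :
    (dWaveKTSystemTT' L t' U μ g hg).C = toEuclideanCLM (n := FockIdx L) (𝕜 := ℂ) ((2 : ℂ)⁻¹ • totalNumber) :=
  rfl

/-- `ō = 2K_g`. [cite: KomaTasaki1994, §2.3 iii)] -/
theorem dWaveKTSystemTT'_obar : (dWaveKTSystemTT' L t' U μ g hg).obar = 2 * pairNormConst g := rfl

/-- `h̄ = 45(2 + |U| + 2|μ|) + 18|t'|`. [cite: KomaTasaki1994, §2.3 iii)] -/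
theorem dWaveKTSystemTT'_hbar :
    (dWaveKTSystemTT' L t' U μ g hg).hbar = 45 * (2 + |U| + 2 * |μ|) + 18 * |t'| := rfl

/-- `r = 45`. [cite: KomaTasaki1994, §2.3 ii)] -/
theorem dWaveKTSystemTT'_r : (dWaveKTSystemTT' L t' U μ g hg).r = 45 := rfl

/-- `r′ = 25`. [cite: KomaTasaki1994, §2.3 i)] -/
theorem dWaveKTSystemTT'_r' : (dWaveKTSystemTT' L t' U μ g hg).r' = 25 := rfl

/-- **The sourced Hamiltonian of the instance**: `H_sys − B·O^{(1)}_sys =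
toEuclideanCLM (hubbardTorusTT' L 1 t' U − μN − B(Δ_g + Δ_g†))`. [cite: KomaTasaki1994, §1, (2.6)] -/
theorem dWaveKTSystemTT'_field (B : ℝ) :
    (dWaveKTSystemTT' L t' U μ g hg).hamiltonian - (B : ℂ) • (dWaveKTSystemTT' L t' U μ g hg).order 0 =
      toEuclideanCLM (n := FockIdx L) (𝕜 := ℂ)
        (hubbardTorusTT' L 1 t' U - (μ : ℂ) • totalNumber - (B : ℂ) • (pairField g L + (pairField g L)ᴴ)) := by
  rw [dWaveKTSystemTT'_hamiltonian, dWaveKTSystemTT'_order_zero, ← map_smul, ← map_sub]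

/-- For `g = dWaveFormFactor` the sourced Hamiltonian is the tree's `dWaveSourceTorusTT' L t' U μ B`.
[cite: KomaTasaki1994, §1] -/
theorem dWaveKTSystemTT'_field_dWave (hd : 0 < pairNormConst dWaveFormFactor) (B : ℝ) :
    (dWaveKTSystemTT' L t' U μ dWaveFormFactor hd).hamiltonian -
        (B : ℂ) • (dWaveKTSystemTT' L t' U μ dWaveFormFactor hd).order 0 =
      toEuclideanCLM (n := FockIdx L) (𝕜 := ℂ) (dWaveSourceTorusTT' L t' U μ B) := by
  rw [dWaveKTSystemTT'_field]
  rfl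

/-- **Hypothesis iv) (2.17) for the `t–t'` instance from matrix data**: a unit Fock vector `Φ` which is an
eigenvector of `hubbardTorusTT' L 1 t' U − μN` (eigenvalue `E₀`) and of the particle number (`NΦ = νΦ`) with
`(μ′·2K_g·L²)² ≤ Re Φ†(Δ_g+Δ_g†)²Φ`, `0 < μ′ ≤ 1`, is an `IsLROEigenstate` with parameter `μ′`.
[cite: KomaTasaki1994, §2.3 iv) (2.17), §3.3] -/
theorem dWaveKTSystemTT'_isLROEigenstate {Φ : FockIdx L → ℂ} {E₀ : ℝ} {ν : ℂ} {μ' : ℝ}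
    (hΦ : star Φ ⬝ᵥ Φ = 1) (hH : (hubbardTorusTT' L 1 t' U - (μ : ℂ) • totalNumber) *ᵥ Φ = (E₀ : ℂ) • Φ)
    (hN : totalNumber *ᵥ Φ = ν • Φ) (hμ : 0 < μ') (hμ1 : μ' ≤ 1)
    (hlro : (μ' * (2 * pairNormConst g) * (L : ℝ) ^ 2) ^ 2 ≤
      (star Φ ⬝ᵥ ((pairField g L + (pairField g L)ᴴ) *ᵥ
        ((pairField g L + (pairField g L)ᴴ) *ᵥ Φ))).re) :
    (dWaveKTSystemTT' L t' U μ g hg).IsLROEigenstate (toLp 2 Φ) E₀ μ' := by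
  set sys := dWaveKTSystemTT' L t' U μ g hg with hsys
  have hC : sys.C (toLp 2 Φ) = ((2 : ℂ)⁻¹ * ν) • toLp 2 Φ := by
    rw [hsys, dWaveKTSystemTT'_C, toEuclideanCLM_toLp, smul_mulVec, hN, smul_smul, toLp_smul]
  refine sys.isLROEigenstate_of ?_ ?_ ⟨_, hC⟩ hμ hμ1 ?_ ?_
  · have h2 : ‖(toLp 2 Φ : EuclideanSpace ℂ (FockIdx L))‖ ^ 2 = 1 := by
      rw [norm_toLp_sq_eq', hΦ, Complex.one_re]
    have h0 : 0 ≤ ‖(toLp 2 Φ : EuclideanSpace ℂ (FockIdx L))‖ := norm_nonneg _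
    nlinarith
  · rw [hsys, dWaveKTSystemTT'_hamiltonian, toEuclideanCLM_toLp, hH, toLp_smul]
  · rw [hsys, dWaveKTSystemTT'_order_zero, toEuclideanCLM_toLp, toEuclideanCLM_toLp, inner_toLp_toLp_eq',
      dWaveKTSystemTT'_obar, card_torusSite_sq', Nat.cast_pow]
    exact hlro
  · have h := KomaTasaki.U1System.inner_order_sq_eq_of_eigen_C sys.collapse
      (show sys.collapse.C (toLp 2 Φ) = ((2 : ℂ)⁻¹ * ν) • toLp 2 Φ from hC)
    rwa [KomaTasaki.U1OverlapSystem.collapse_order, KomaTasaki.U1OverlapSystem.collapse_order] at h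

end Dictionary

end Literature.MathematicalPhysics.QuantumLattice

end
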